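import Summits.CriticalPhenomena.SAWScalingLimit.Theorems.SAWLeftRightFKGFKGToTraversalBoundGatesDefs
import Summits.CriticalPhenomena.SAWScalingLimit.Theorems.SAWLeftRightFKGSAWTraversalBound
import HarnessLib

/-!
# Slit necklace, piece 1: per-shell tightness on a mesh class is an EVENTUAL statement

Crux `SAWLeftRightFKG.FKGToTraversalBound` (stmt-CriticalPhenomena-1878), line
`gates-by-bubble-doors-by-fkg`, registered helper `necklace_shellTightOn_of_eventually` of the stub
`stub_necklace` (`SAWCollarBound → GermExcursionMean → DeepShellTight`).

The currency of the line's deep fragment is `ShellTightOn P M D a b` (vocabulary file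
`SAWLeftRightFKGFKGToTraversalBoundGatesDefs`): ONE `δ₀ > 0` for the approximation, then for every shell
`D(x; ρ, R)` of modulus `≥ M` and every `ε > 0` a threshold `n` with
`P_δ(n separate traversals) ≤ ε` at every mesh `δ ≤ min ρ δ₀` of the class `P`.  The necklace argument,
like every per-shell argument, naturally proves only an EVENTUAL statement shell by shell (the depth
`dist(δ a_δ, ∂D) → 0` must first drop below the shell's own scale).  This file certifies that for
`M > 1` the two are the same (`necklace_shellTightOn_iff_eventually`):

* `necklace_shellTightOn_of_eventually` (registered) — eventual per-shell bounds give `ShellTightOn`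
  with `δ₀ = 1`: below the eventual range `δ < δ₁(shell, ε)` use the hypothesis, and at meshes
  `δ ∈ [δ₁, 1]` the event `{2 (#box + 1) + 1 separate traversals}` is EMPTY by the deterministic
  short-distance count of the tree (`Theorems.hasTraversals_toCurve_le`: a polyline with `N` edges
  traverses a genuine shell at most `2 (N + 1)` times; `Theorems.length_support_tail_le`: a
  self-avoiding walk of `Ω_δ`, `δ ≥ δ₁`, has at most `#([-⌈r/δ₁⌉, ⌈r/δ₁⌉]²)` steps) — ideator 5's
  `EventualShellReduction` in the line's currency;
* `shellTightOn_eventually` — the (trivial) converse.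

Only theorems; no named fact; axioms are the standard three.
-/

noncomputable section

open MeasureTheory Filter Topology Set Metric
open scoped NNReal ENNReal
open Literature.Probability.LatticeModels
open Literature.Probability.RandomPlanarGeometry
open Literature.Probability.RandomPlanarGeometry.SAW
open Summit.CriticalPhenomena.SAWScalingLimit.Theses.SAWLeftRightFKG

namespace Summit.CriticalPhenomena.SAWScalingLimit.Theorems.FKGToTraversalBound.GatesByBubbleDoorsByFKG

/-- **At meshes bounded below the traversal event is empty.**  If `D ⊆ B̄(0, r)`, `0 < δ₁ ≤ δ` and
`ρ < R`, no self-avoiding walk of `D_δ` has `2 (#([-⌈r/δ₁⌉, ⌈r/δ₁⌉]²) + 1) + 1` separate traversals of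
`D(x; ρ, R)` (`hasTraversals_toCurve_le` with `length_support_tail_le`). [folklore] -/
theorem traversalEvent_eq_empty_of_le_mesh {Ω : Set ℂ} {r δ₁ δ : ℝ} (hΩ : Ω ⊆ closedBall (0 : ℂ) r)
    (hδ₁ : 0 < δ₁) (hδ : δ₁ ≤ δ) (u v : Site 2) {x : ℂ} {ρ R : ℝ} (hρR : ρ < R) {n : ℕ}
    (hn : 2 * ((Fintype.piFinset fun _ : Fin 2 => Finset.Icc (-⌈r / δ₁⌉) ⌈r / δ₁⌉).card + 1) + 1 ≤ n) :
    {γ : DomainSAW Ω δ u v |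
        (⟨γ.walk.toCurve (meshPoint δ)⟩ : Curve ℂ).HasTraversals n x ρ R} = ∅ := by
  classical
  refine Set.eq_empty_of_forall_notMem fun γ hγ => ?_
  have hk : (⟨γ.walk.toCurve (meshPoint δ)⟩ : Curve ℂ).HasTraversals
      (2 * ((Fintype.piFinset fun _ : Fin 2 => Finset.Icc (-⌈r / δ₁⌉) ⌈r / δ₁⌉).card + 1) + 1)
      x ρ R := hγ.of_le hn
  have hle := Theorems.hasTraversals_toCurve_le (meshPoint δ) γ.walk hρR hk
  have htail := Theorems.length_support_tail_le hΩ hδ₁ hδ γ.walk γ.isPath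
  omega

/-- **Registered helper `necklace_shellTightOn_of_eventually`** (crux stmt-CriticalPhenomena-1878, stub
`stub_necklace`): **eventual per-shell bounds give per-shell tightness on a mesh class** (`δ₀ = 1`).
For `M > 1`, if for every shell `D(x; ρ, R)` (`0 < ρ`, `M ρ ≤ R ≤ 1`) and every `ε > 0` some threshold
`n` has `P_δ(n separate traversals) ≤ ε` on the class `P` for all sufficiently small `δ > 0`, then
`ShellTightOn P M D a b`: below the eventual range the hypothesis (`HasTraversals.of_le`), above it the
event is empty (`traversalEvent_eq_empty_of_le_mesh`; `ρ < R` because `M > 1`). [folklore] -/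
theorem necklace_shellTightOn_of_eventually :
    ∀ (P : ℝ → Prop) (M : ℝ) (D : DobrushinDomain) (a b : ℝ → Site 2), 1 < M →
      (∀ (x : ℂ) (ρ R : ℝ), 0 < ρ → M * ρ ≤ R → R ≤ 1 → ∀ ε : ℝ, 0 < ε → ∃ n : ℕ,
        ∀ᶠ δ in 𝓝[>] (0 : ℝ), P δ →
          SAW.law D.carrier δ (a δ) (b δ)
              {γ | (⟨γ.walk.toCurve (meshPoint δ)⟩ : Curve ℂ).HasTraversals n x ρ R} ≤
            ENNReal.ofReal ε) →
      ShellTightOn P M D a b := by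
  classical
  intro P M D a b hM h
  obtain ⟨r, hr⟩ := (Metric.isBounded_iff_subset_closedBall (0 : ℂ)).1 D.isBounded
  refine ⟨1, one_pos, ?_⟩
  intro x ρ R hρ hMR hR1 ε hε
  have hρR : ρ < R := by
    have : ρ < M * ρ := by nlinarith
    exact this.trans_le hMR
  obtain ⟨n₁, hn₁⟩ := h x ρ R hρ hMR hR1 ε hε
  obtain ⟨δ₁, hδ₁, hsub⟩ := mem_nhdsGT_iff_exists_Ioo_subset.1 hn₁
  have hδ₁pos : 0 < δ₁ := hδ₁
  set n₂ : ℕ :=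
    2 * ((Fintype.piFinset fun _ : Fin 2 => Finset.Icc (-⌈r / δ₁⌉) ⌈r / δ₁⌉).card + 1) + 1 with hn₂
  refine ⟨max n₁ n₂, fun δ hδ _hδρ hP => ?_⟩
  by_cases hsmall : δ < δ₁
  · -- eventual regime
    have h1 := hsub ⟨hδ.1, hsmall⟩ hP
    refine le_trans (measure_mono fun γ hγ => ?_) h1
    exact Curve.HasTraversals.of_le hγ (le_max_left _ _)
  · -- large mesh: the event is empty
    rw [traversalEvent_eq_empty_of_le_mesh hr hδ₁pos (not_lt.1 hsmall) (a δ) (b δ) hρR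
      (le_max_right n₁ n₂), measure_empty]
    exact bot_le

/-- **Converse**: per-shell tightness on a mesh class gives the eventual per-shell bounds (the meshes
`δ < min δ₀ ρ` form a right-neighbourhood of `0`). [folklore] -/
theorem shellTightOn_eventually {P : ℝ → Prop} {M : ℝ} {D : DobrushinDomain} {a b : ℝ → Site 2}
    (h : ShellTightOn P M D a b) :
    ∀ (x : ℂ) (ρ R : ℝ), 0 < ρ → M * ρ ≤ R → R ≤ 1 → ∀ ε : ℝ, 0 < ε → ∃ n : ℕ,
      ∀ᶠ δ in 𝓝[>] (0 : ℝ), P δ →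
        law D.carrier δ (a δ) (b δ)
            {γ | (⟨γ.walk.toCurve (meshPoint δ)⟩ : Curve ℂ).HasTraversals n x ρ R} ≤
          ENNReal.ofReal ε := by
  obtain ⟨δ₀, hδ₀, H⟩ := h
  intro x ρ R hρ hMR hR1 ε hε
  obtain ⟨n, hn⟩ := H x ρ R hρ hMR hR1 ε hε
  refine ⟨n, ?_⟩
  have hmem : Set.Ioo (0 : ℝ) (min δ₀ ρ) ∈ 𝓝[>] (0 : ℝ) := Ioo_mem_nhdsGT (lt_min hδ₀ hρ)
  filter_upwards [hmem] with δ hδ hP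
  exact hn δ ⟨hδ.1, hδ.2.le.trans (min_le_left _ _)⟩ (hδ.2.le.trans (min_le_right _ _)) hP

/-- **`ShellTightOn` is an eventual statement** for moduli `M > 1`: per-shell tightness of the
traversal counts on a mesh class holds iff, shell by shell and `ε` by `ε`, one threshold works for all
sufficiently small meshes of the class. [folklore] -/
theorem necklace_shellTightOn_iff_eventually {P : ℝ → Prop} {M : ℝ} {D : DobrushinDomain}
    {a b : ℝ → Site 2} (hM : 1 < M) :
    ShellTightOn P M D a b ↔
      ∀ (x : ℂ) (ρ R : ℝ), 0 < ρ → M * ρ ≤ R → R ≤ 1 → ∀ ε : ℝ, 0 < ε → ∃ n : ℕ,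
        ∀ᶠ δ in 𝓝[>] (0 : ℝ), P δ →
          law D.carrier δ (a δ) (b δ)
              {γ | (⟨γ.walk.toCurve (meshPoint δ)⟩ : Curve ℂ).HasTraversals n x ρ R} ≤
            ENNReal.ofReal ε :=
  ⟨shellTightOn_eventually, necklace_shellTightOn_of_eventually P M D a b hM⟩

end Summit.CriticalPhenomena.SAWScalingLimit.Theorems.FKGToTraversalBound.GatesByBubbleDoorsByFKG

end
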